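import Summits.RiemannHypothesis.RiemannHypothesis.Theorems.Splittings.SplitXWucK1RA
import HarnessLib

/-!
# Splittings — x-wuc GEN-11 `SplitXWucK1R` (K1′(ℝ) AT THE STAKE) — mechanical carve part 2/14
Continuation of `Summits.RiemannHypothesis.RiemannHypothesis.Theorems.Splittings.SplitXWucK1RA`: byte-identical declaration units of the referee-passed extract `SplitXWucK1R.lean`
sha16 70c8eb2af2868881 (x-wuc g11; ref g10 PASS 2026-08-27T22:59:46Z; RULING #330); open namespaces/sections re-opened with their context.
HONEST LABEL: splitting search over kernel-typed RH-equivalences; K-CERT′ (complex `f`) stays OPEN; nothing here bears on the truth of RH.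
-/
set_option linter.dupNamespace false
noncomputable section
open scoped Classical ComplexConjugate
open Set Filter Topology Complex MeasureTheory
open Real Set Filter Topology
namespace Summit.RiemannHypothesis.RiemannHypothesis.Theorems.Splittings.XWucG8.DSLine
/-- core: if additionally `|S| < M` everywhere, the angle `arccos (S/M)` is 1-Lipschitz. -/
theorem arccos_lipschitz_of_sq_add_sq_le {S : ℝ → ℝ} {M : ℝ} (hM : 0 < M)
    (hS : Differentiable ℝ S) (hDS : ∀ x, deriv S x ^ 2 + S x ^ 2 ≤ M ^ 2)
    (hlt : ∀ x, |S x| < M) (t : ℝ) :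
    Real.arccos (S t / M) ≤ Real.arccos (S 0 / M) + |t| := by
  set ψ : ℝ → ℝ := fun x => Real.arccos (S x / M) with hψ
  have hne : ∀ x, S x / M ≠ -1 ∧ S x / M ≠ 1 := by
    intro x
    have h := hlt x
    rw [abs_lt] at h
    constructor
    · intro h1; have : S x = -M := by field_simp at h1; linarith
      linarith
    · intro h1; have : S x = M := by field_simp at h1; linarith
      linarith
  have hderiv : ∀ x, HasDerivAt ψ (-(1 / √(1 - (S x / M) ^ 2)) * (deriv S x / M)) x := by
    intro x
    have h1 : HasDerivAt (fun y => S y / M) (deriv S x / M) x := (hS x).hasDerivAt.div_const M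
    have h2 : HasDerivAt (Real.arccos ∘ fun y => S y / M)
        (-(1 / √(1 - (S x / M) ^ 2)) * (deriv S x / M)) x :=
      (Real.hasDerivAt_arccos (hne x).1 (hne x).2).comp x h1
    exact h2
  have hdiff : ∀ x ∈ (univ : Set ℝ), DifferentiableAt ℝ ψ x := fun x _ => (hderiv x).differentiableAt
  have hbound : ∀ x ∈ (univ : Set ℝ), ‖deriv ψ x‖ ≤ 1 := by
    intro x _
    rw [(hderiv x).deriv]
    have hlt' := hlt x
    rw [abs_lt] at hlt'
    have hpos : 0 < 1 - (S x / M) ^ 2 := by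
      have : (S x / M) ^ 2 < 1 := by
        rw [div_pow, div_lt_one (by positivity)]
        nlinarith [hlt'.1, hlt'.2]
      linarith
    have hsq : 0 < √(1 - (S x / M) ^ 2) := Real.sqrt_pos.mpr hpos
    rw [Real.norm_eq_abs, abs_mul, abs_neg, abs_div, abs_one, abs_of_pos hsq, one_div,
      ← div_eq_inv_mul, div_le_one hsq, abs_div, abs_of_pos hM]
    rw [div_le_iff₀ hM]
    -- |S'| ≤ M √(1 - S²/M²)  ⇐  S'² ≤ M² (1 - S²/M²) = M² - S²
    have hrhs : 0 ≤ √(1 - (S x / M) ^ 2) * M := by positivity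
    rw [← abs_of_nonneg hrhs, ← sq_le_sq, mul_pow, Real.sq_sqrt hpos.le]
    have : (1 - (S x / M) ^ 2) * M ^ 2 = M ^ 2 - S x ^ 2 := by field_simp
    rw [this]; linarith [hDS x]
  have key := Convex.norm_image_sub_le_of_norm_deriv_le hdiff hbound convex_univ (mem_univ 0) (mem_univ t)
  rw [Real.norm_eq_abs, Real.norm_eq_abs, sub_zero] at key
  have := (abs_le.mp key).2
  simp only [hψ] at this ⊢; linarith

/-- **DS lobe.** `S'^2 + S^2 ≤ M^2` on `ℝ` and `S 0 = M` force `M cos t ≤ S t` for `|t| ≤ π`. -/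
theorem cos_lobe_of_sq_add_sq_le {S : ℝ → ℝ} {M : ℝ} (hM : 0 < M)
    (hS : Differentiable ℝ S) (hDS : ∀ x, deriv S x ^ 2 + S x ^ 2 ≤ M ^ 2) (h0 : S 0 = M)
    {t : ℝ} (ht : |t| ≤ π) : M * Real.cos t ≤ S t := by
  -- ε-regularisation: S_ε := (1 - ε) S has |S_ε| < M.
  have hSM : ∀ x, |S x| ≤ M := by
    intro x
    have h := hDS x
    exact abs_le_of_sq_le_sq (by nlinarith [sq_nonneg (deriv S x)]) hM.le
  have hmain : ∀ ε : ℝ, 0 < ε → ε < 1 → M * Real.cos t - M * Real.arccos (1 - ε) ≤ (1 - ε) * S t := by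
    intro ε hε0 hε1
    set Se : ℝ → ℝ := fun x => (1 - ε) * S x with hSe
    have hSe_diff : Differentiable ℝ Se := by
      intro x; exact (hS x).const_mul _
    have hSe_deriv : ∀ x, deriv Se x = (1 - ε) * deriv S x := by
      intro x; simp only [hSe]; exact deriv_const_mul _ (hS x)
    have hSe_DS : ∀ x, deriv Se x ^ 2 + Se x ^ 2 ≤ M ^ 2 := by
      intro x
      rw [hSe_deriv]; simp only [hSe]
      have h := hDS x
      have h1 : (1 - ε) ^ 2 ≤ 1 := by nlinarith
      calc ((1 - ε) * deriv S x) ^ 2 + ((1 - ε) * S x) ^ 2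
          = (1 - ε) ^ 2 * (deriv S x ^ 2 + S x ^ 2) := by ring
        _ ≤ 1 * M ^ 2 := by gcongr
        _ = M ^ 2 := one_mul _
    have hSe_lt : ∀ x, |Se x| < M := by
      intro x; simp only [hSe]
      rw [abs_mul, abs_of_pos (by linarith)]
      calc (1 - ε) * |S x| ≤ (1 - ε) * M := mul_le_mul_of_nonneg_left (hSM x) (by linarith)
        _ < M := by nlinarith
    have core := arccos_lipschitz_of_sq_add_sq_le hM hSe_diff hSe_DS hSe_lt t
    have hSe0 : Se 0 / M = 1 - ε := by simp only [hSe]; rw [h0]; field_simp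
    rw [hSe0] at core
    -- cos is antitone on [0, π]: cos (arccos (Se t / M)) ≥ cos (min π (arccos (1-ε) + |t|))
    have hψ_le : Real.arccos (Se t / M) ≤ min π (Real.arccos (1 - ε) + |t|) :=
      le_min (Real.arccos_le_pi _) core
    have hcos : Real.cos (min π (Real.arccos (1 - ε) + |t|)) ≤ Real.cos (Real.arccos (Se t / M)) :=
      Real.cos_le_cos_of_nonneg_of_le_pi (Real.arccos_nonneg _) (min_le_left _ _) hψ_le
    have hval : Real.cos (Real.arccos (Se t / M)) = Se t / M := by
      have h := hSe_lt t; rw [abs_lt] at h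
      apply Real.cos_arccos
      · rw [le_div_iff₀ hM]; linarith
      · rw [div_le_iff₀ hM]; linarith
    rw [hval] at hcos
    -- cos is 1-Lipschitz: cos (min π (a + |t|)) ≥ cos |t| - a, and cos |t| = cos t
    have hlip : Real.cos |t| - Real.arccos (1 - ε) ≤ Real.cos (min π (Real.arccos (1 - ε) + |t|)) := by
      have h1 := Real.abs_cos_sub_cos_le (min π (Real.arccos (1 - ε) + |t|)) |t|
      have h2 : abs (min π (Real.arccos (1 - ε) + abs t) - abs t) ≤ Real.arccos (1 - ε) := by
        rw [abs_le]; constructor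
        · have hh : min π (Real.arccos (1 - ε) + |t|) ≥ |t| :=
            le_min ht (by linarith [Real.arccos_nonneg (1 - ε)])
          linarith [Real.arccos_nonneg (1 - ε)]
        · linarith [min_le_right π (Real.arccos (1 - ε) + |t|)]
      have h3 := (abs_le.mp (h1.trans h2)).1
      linarith
    rw [Real.cos_abs] at hlip
    have : M * (Real.cos t - Real.arccos (1 - ε)) ≤ M * (Se t / M) := by
      exact mul_le_mul_of_nonneg_left (hlip.trans hcos) hM.le
    have h4 : M * (Se t / M) = (1 - ε) * S t := by simp only [hSe]; field_simp
    rw [h4] at this; linarith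
  -- let ε → 0⁺
  have h_lhs : Tendsto (fun ε : ℝ => M * Real.cos t - M * Real.arccos (1 - ε)) (𝓝[>] 0)
      (𝓝 (M * Real.cos t - M * Real.arccos (1 - 0))) := by
    have hc : Continuous (fun ε : ℝ => M * Real.cos t - M * Real.arccos (1 - ε)) := by
      have := Real.continuous_arccos
      continuity
    exact (hc.tendsto 0).mono_left nhdsWithin_le_nhds
  have h_rhs : Tendsto (fun ε : ℝ => (1 - ε) * S t) (𝓝[>] 0) (𝓝 ((1 - 0) * S t)) := by
    have hc : Continuous (fun ε : ℝ => (1 - ε) * S t) := by continuity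
    exact (hc.tendsto 0).mono_left nhdsWithin_le_nhds
  rw [sub_zero, Real.arccos_one, mul_zero, sub_zero] at h_lhs
  rw [sub_zero, one_mul] at h_rhs
  have hev : ∀ᶠ ε in 𝓝[>] (0 : ℝ), M * Real.cos t - M * Real.arccos (1 - ε) ≤ (1 - ε) * S t := by
    filter_upwards [Ioo_mem_nhdsGT (zero_lt_one' ℝ)] with ε hε using hmain ε hε.1 hε.2
  exact le_of_tendsto_of_tendsto h_lhs h_rhs hev

end Summit.RiemannHypothesis.RiemannHypothesis.Theorems.Splittings.XWucG8.DSLine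
open Real Set MeasureTheory Complex Filter Topology
open scoped Real
namespace Summit.RiemannHypothesis.RiemannHypothesis.Theorems.Splittings.XWucG8.CoshKernel
section coefficients
variable [hT : Fact ((0 : ℝ) < 2)]
/-- `u ↦ cosh (κ u)` on `[-1,1)`, made 2-periodic. -/
noncomputable def coshLift (κ : ℝ) : C(AddCircle (2 : ℝ), ℂ) :=
  ⟨AddCircle.liftIco 2 (-1) (fun u : ℝ => (Real.cosh (κ * u) : ℂ)),
    AddCircle.liftIco_continuous
      (by
        show ((Real.cosh (κ * (-1)) : ℝ) : ℂ) = ((Real.cosh (κ * (-1 + 2)) : ℝ) : ℂ)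
        norm_num [Real.cosh_neg])
      (by fun_prop)⟩

/-- `coshLift_apply` — helper of the x-wuc GEN-11 chain «K1′(ℝ) at the stake» (verbatim from the referee-passed extract `SplitXWucK1R.lean` 70c8eb2af2868881; role: see the module docstring). -/
theorem coshLift_apply (κ : ℝ) {u : ℝ} (hu : u ∈ Icc (-1 : ℝ) 1) :
    coshLift κ (u : AddCircle (2 : ℝ)) = (Real.cosh (κ * u) : ℂ) := by
  rcases eq_or_lt_of_le hu.2 with h | h
  · -- u = 1 ≡ -1 (mod 2)
    subst h
    have h1 : ((1 : ℝ) : AddCircle (2 : ℝ)) = ((-1 : ℝ) : AddCircle (2 : ℝ)) := by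
      have := AddCircle.coe_add_period (2 : ℝ) (-1 : ℝ)
      norm_num at this; exact this
    show AddCircle.liftIco 2 (-1) (fun u : ℝ => (Real.cosh (κ * u) : ℂ)) ((1 : ℝ) : AddCircle (2:ℝ)) = _
    rw [h1, AddCircle.liftIco_coe_apply (by norm_num)]
    simp [Real.cosh_neg]
  · show AddCircle.liftIco 2 (-1) (fun u : ℝ => (Real.cosh (κ * u) : ℂ)) (u : AddCircle (2:ℝ)) = _
    rw [AddCircle.liftIco_coe_apply]
    constructor
    · exact hu.1
    · linarith

omit hT in
/-- the basic integral: `∫_{-1}^{1} e^{-iπ n u} cosh(κ u) du = 2 κ sinh κ cos(π n) / (κ² + π² n²)`. -/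
theorem integral_exp_mul_cosh (κ : ℝ) (hκ : 0 < κ) (n : ℤ) :
    ∫ u in (-1 : ℝ)..1, cexp (-(π * n * I) * u) * (Real.cosh (κ * u) : ℂ)
      = ((2 * κ * Real.sinh κ * Real.cos (π * n) / (κ ^ 2 + π ^ 2 * n ^ 2) : ℝ) : ℂ) := by
  set c : ℂ := -(π * n * I) with hc
  set D : ℂ := (κ : ℂ) ^ 2 + (π : ℂ) ^ 2 * (n : ℂ) ^ 2 with hD
  have hDre : D = ((κ ^ 2 + π ^ 2 * n ^ 2 : ℝ) : ℂ) := by simp [hD]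
  have hD0 : D ≠ 0 := by
    rw [hDre, Complex.ofReal_ne_zero]; positivity
  -- antiderivative G
  set G : ℝ → ℂ := fun u => cexp (c * u) * ((κ : ℂ) * Complex.sinh (κ * u)
      + (π * n * I) * Complex.cosh (κ * u)) / D with hG
  have hGderiv : ∀ u : ℝ, HasDerivAt G (cexp (c * u) * (Real.cosh (κ * u) : ℂ)) u := by
    intro u
    have h1 : HasDerivAt (fun u : ℝ => cexp (c * u)) (cexp (c * u) * c) u := by
      have : HasDerivAt (fun u : ℝ => c * (u : ℂ)) (c * 1) u :=
        (hasDerivAt_id u).ofReal_comp.const_mul c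
      simpa using this.cexp
    have hlin : HasDerivAt (fun u : ℝ => (κ : ℂ) * (u : ℂ)) ((κ : ℂ) * 1) u :=
      (hasDerivAt_id u).ofReal_comp.const_mul (κ : ℂ)
    have h2 : HasDerivAt (fun u : ℝ => (κ : ℂ) * Complex.sinh (κ * u))
        ((κ : ℂ) * (Complex.cosh ((κ : ℂ) * u) * ((κ : ℂ) * 1))) u :=
      by
        have := ((Complex.hasDerivAt_sinh ((κ : ℂ) * u)).comp u hlin).const_mul (κ : ℂ)
        simpa [Function.comp_def] using this
    have h3 : HasDerivAt (fun u : ℝ => (π * n * I) * Complex.cosh (κ * u))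
        ((π * n * I) * (Complex.sinh ((κ : ℂ) * u) * ((κ : ℂ) * 1))) u :=
      by
        have := ((Complex.hasDerivAt_cosh ((κ : ℂ) * u)).comp u hlin).const_mul (π * n * I : ℂ)
        simpa [Function.comp_def] using this
    have h4 : HasDerivAt (fun u : ℝ => cexp (c * u) * ((κ : ℂ) * Complex.sinh (κ * u)
        + (π * n * I) * Complex.cosh (κ * u)) / D)
        ((cexp (c * u) * c * ((κ : ℂ) * Complex.sinh (κ * u) + (π * n * I) * Complex.cosh (κ * u))
          + cexp (c * u) * ((κ : ℂ) * (Complex.cosh ((κ : ℂ) * u) * ((κ : ℂ) * 1))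
            + (π * n * I) * (Complex.sinh ((κ : ℂ) * u) * ((κ : ℂ) * 1)))) / D) u :=
      (h1.mul (h2.add h3)).div_const D
    refine h4.congr_deriv ?_
    rw [div_eq_iff hD0, Complex.ofReal_cosh, hc, hD]; push_cast; ring_nf
    rw [Complex.I_sq]; ring
  have hint : IntervalIntegrable (fun u : ℝ => cexp (c * u) * (Real.cosh (κ * u) : ℂ)) volume (-1) 1 := by
    apply Continuous.intervalIntegrable; fun_prop
  rw [intervalIntegral.integral_eq_sub_of_hasDerivAt (fun u _ => hGderiv u) hint]
  -- evaluate G 1 - G (-1)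
  have hexp1 : cexp (c * (1 : ℝ)) = (Real.cos (π * n) : ℂ) := by
    rw [hc, Complex.ofReal_one, mul_one,
      show -(↑π * ↑n * I) = ((-(π * n) : ℝ) : ℂ) * I by push_cast; ring, Complex.exp_mul_I,
      ← Complex.ofReal_cos, ← Complex.ofReal_sin, Real.cos_neg, Real.sin_neg,
      show (π * n : ℝ) = n * π by ring, Real.sin_int_mul_pi]
    simp
  have hexp2 : cexp (c * (-1 : ℝ)) = (Real.cos (π * n) : ℂ) := by
    rw [hc, show c * ((-1 : ℝ) : ℂ) = ((π * n : ℝ) : ℂ) * I by rw [hc]; push_cast; ring,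
      Complex.exp_mul_I, ← Complex.ofReal_cos, ← Complex.ofReal_sin,
      show (π * n : ℝ) = n * π by ring, Real.sin_int_mul_pi]
    simp
  simp only [hG]
  rw [hexp1, hexp2, hDre]
  have hD0' : ((κ ^ 2 + π ^ 2 * n ^ 2 : ℝ) : ℂ) ≠ 0 := by rw [← hDre]; exact hD0
  push_cast at hD0' ⊢
  rw [mul_one, mul_neg_one, Complex.sinh_neg, Complex.cosh_neg]
  field_simp
  ring

/-- the Fourier coefficients of `coshLift κ`. -/
noncomputable def cc (κ : ℝ) (n : ℤ) : ℝ :=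
  κ * Real.sinh κ * Real.cos (π * n) / (κ ^ 2 + π ^ 2 * n ^ 2)

/-- `fourierCoeff_coshLift` — helper of the x-wuc GEN-11 chain «K1′(ℝ) at the stake» (verbatim from the referee-passed extract `SplitXWucK1R.lean` 70c8eb2af2868881; role: see the module docstring). -/
theorem fourierCoeff_coshLift (κ : ℝ) (hκ : 0 < κ) (n : ℤ) :
    fourierCoeff (⇑(coshLift κ) : AddCircle (2:ℝ) → ℂ) n = (cc κ n : ℂ) := by
  rw [fourierCoeff_eq_intervalIntegral (⇑(coshLift κ)) n (-1)]
  have hcongr : EqOn (fun x : ℝ => (fourier (-n)) (x : AddCircle (2:ℝ)) • (coshLift κ) (x : AddCircle (2:ℝ)))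
      (fun x : ℝ => cexp (-(π * n * I) * x) * (Real.cosh (κ * x) : ℂ)) (uIcc (-1 : ℝ) (-1 + 2)) := by
    intro x hx
    rw [uIcc_of_le (by norm_num)] at hx
    have hx' : x ∈ Icc (-1 : ℝ) 1 := ⟨hx.1, by linarith [hx.2]⟩
    simp only [smul_eq_mul]
    rw [coshLift_apply κ hx', fourier_coe_apply]
    congr 1; congr 1; push_cast; ring
  rw [intervalIntegral.integral_congr hcongr, show (-1 : ℝ) + 2 = 1 by norm_num,
    integral_exp_mul_cosh κ hκ n]
  simp only [cc]
  rw [Complex.real_smul]; push_cast; ring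

omit hT in
/-- `abs_cos_pi_mul_int` — helper of the x-wuc GEN-11 chain «K1′(ℝ) at the stake» (verbatim from the referee-passed extract `SplitXWucK1R.lean` 70c8eb2af2868881; role: see the module docstring). -/
theorem abs_cos_pi_mul_int (n : ℤ) : |Real.cos (π * n)| = 1 := by
  have hs : Real.sin (π * n) = 0 := by rw [mul_comm]; exact Real.sin_int_mul_pi n
  have h := Real.sin_sq_add_cos_sq (π * n)
  rw [hs] at h
  have h2 : |Real.cos (π * n)| ^ 2 = 1 := by rw [sq_abs]; linarith
  nlinarith [abs_nonneg (Real.cos (π * n))]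

omit hT in
/-- `norm_cc` — helper of the x-wuc GEN-11 chain «K1′(ℝ) at the stake» (verbatim from the referee-passed extract `SplitXWucK1R.lean` 70c8eb2af2868881; role: see the module docstring). -/
theorem norm_cc (κ : ℝ) (hκ : 0 < κ) (n : ℤ) :
    ‖(cc κ n : ℂ)‖ = κ * Real.sinh κ / (κ ^ 2 + π ^ 2 * n ^ 2) := by
  rw [Complex.norm_real, Real.norm_eq_abs, cc, abs_div, abs_mul,
    abs_of_nonneg (by positivity : 0 ≤ κ * Real.sinh κ), abs_cos_pi_mul_int, mul_one,
    abs_of_pos (by positivity)]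

omit hT in
/-- `cc_zero` — helper of the x-wuc GEN-11 chain «K1′(ℝ) at the stake» (verbatim from the referee-passed extract `SplitXWucK1R.lean` 70c8eb2af2868881; role: see the module docstring). -/
theorem cc_zero (κ : ℝ) (hκ : 0 < κ) : cc κ 0 = Real.sinh κ / κ := by
  simp only [cc, Int.cast_zero, mul_zero, Real.cos_zero, mul_one]
  field_simp; ring

omit hT in
/-- `summable_norm_cc` — helper of the x-wuc GEN-11 chain «K1′(ℝ) at the stake» (verbatim from the referee-passed extract `SplitXWucK1R.lean` 70c8eb2af2868881; role: see the module docstring). -/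
theorem summable_norm_cc (κ : ℝ) (hκ : 0 < κ) : Summable (fun n : ℤ => ‖(cc κ n : ℂ)‖) := by
  have hb : Summable (fun n : ℤ => (if n = 0 then Real.sinh κ / κ else 0)
      + κ * Real.sinh κ / π ^ 2 * (1 / (n : ℝ) ^ 2)) := by
    apply Summable.add
    · exact (hasSum_ite_eq (0 : ℤ) (Real.sinh κ / κ)).summable
    · exact (Real.summable_one_div_int_pow.mpr one_lt_two).mul_left _
  refine Summable.of_nonneg_of_le (fun n => norm_nonneg _) (fun n => ?_) hb
  rw [norm_cc κ hκ]
  rcases eq_or_ne n 0 with h | h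
  · subst h; simp; field_simp; simp
  · rw [if_neg h, zero_add]
    have hn : (0 : ℝ) < (n : ℝ) ^ 2 := by positivity
    rw [mul_one_div, div_div, div_le_div_iff₀ (by positivity) (by positivity)]
    have : 0 ≤ κ * Real.sinh κ * κ ^ 2 := by positivity
    nlinarith [this]

/-- `summable_fourierCoeff_coshLift` — helper of the x-wuc GEN-11 chain «K1′(ℝ) at the stake» (verbatim from the referee-passed extract `SplitXWucK1R.lean` 70c8eb2af2868881; role: see the module docstring). -/
theorem summable_fourierCoeff_coshLift (κ : ℝ) (hκ : 0 < κ) :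
    Summable (fourierCoeff (⇑(coshLift κ) : AddCircle (2:ℝ) → ℂ)) := by
  have : (fourierCoeff (⇑(coshLift κ) : AddCircle (2:ℝ) → ℂ)) = fun n => (cc κ n : ℂ) := by
    funext n; exact fourierCoeff_coshLift κ hκ n
  rw [this]
  exact (summable_norm_cc κ hκ).of_norm

/-- the Fourier expansion of `cosh (κ u)` on `[-1, 1]`. -/
theorem hasSum_cosh (κ : ℝ) (hκ : 0 < κ) {u : ℝ} (hu : u ∈ Icc (-1 : ℝ) 1) :
    HasSum (fun n : ℤ => (cc κ n : ℂ) * cexp (π * n * u * I)) (Real.cosh (κ * u) : ℂ) := by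
  have h := has_pointwise_sum_fourier_series_of_summable (summable_fourierCoeff_coshLift κ hκ)
    (u : AddCircle (2:ℝ))
  rw [coshLift_apply κ hu] at h
  convert h using 1
  funext n
  rw [fourierCoeff_coshLift κ hκ n, smul_eq_mul, fourier_coe_apply]
  congr 1; congr 1; push_cast; ring

/-- `Σ_n ‖c_n‖ = cosh κ` (the expansion at `u = 1`, where all terms are `≥ 0`). -/
theorem hasSum_norm_cc (κ : ℝ) (hκ : 0 < κ) :
    HasSum (fun n : ℤ => ‖(cc κ n : ℂ)‖) (Real.cosh κ) := by
  have h := hasSum_cosh κ hκ (u := 1) ⟨by norm_num, le_rfl⟩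
  have hterm : ∀ n : ℤ, (cc κ n : ℂ) * cexp (π * n * (1 : ℝ) * I) = ((‖(cc κ n : ℂ)‖ : ℝ) : ℂ) := by
    intro n
    have hsin : Real.sin (π * n) = 0 := by rw [mul_comm]; exact Real.sin_int_mul_pi n
    have hexp : cexp (π * n * (1 : ℝ) * I) = (Real.cos (π * n) : ℂ) := by
      rw [Complex.ofReal_one, mul_one, show (π : ℂ) * n * I = ((π * n : ℝ) : ℂ) * I by push_cast; ring,
        Complex.exp_mul_I, ← Complex.ofReal_cos, ← Complex.ofReal_sin, hsin]
      simp
    have hcos2 : Real.cos (π * n) ^ 2 = 1 := by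
      nlinarith [abs_cos_pi_mul_int n, sq_abs (Real.cos (π * n))]
    have hreal : cc κ n * Real.cos (π * n) = κ * Real.sinh κ / (κ ^ 2 + π ^ 2 * n ^ 2) := by
      simp only [cc]
      rw [show κ * Real.sinh κ * Real.cos (π * n) / (κ ^ 2 + π ^ 2 * n ^ 2) * Real.cos (π * n)
          = κ * Real.sinh κ * (Real.cos (π * n)) ^ 2 / (κ ^ 2 + π ^ 2 * n ^ 2) by ring, hcos2, mul_one]
    rw [hexp, ← Complex.ofReal_mul, hreal, norm_cc κ hκ]
  simp_rw [hterm] at h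
  simp only [mul_one] at h
  exact Complex.hasSum_ofReal.mp h

end coefficients
section dent
/-- `tfT_interval` — helper of the x-wuc GEN-11 chain «K1′(ℝ) at the stake» (verbatim from the referee-passed extract `SplitXWucK1R.lean` 70c8eb2af2868881; role: see the module docstring). -/
theorem tfT_interval (f : ℝ → ℂ) (lam κ : ℝ) :
    tfT f lam κ = ∫ u in (-1 : ℝ)..1, f u * (Real.cosh (κ * u) : ℂ) * cexp (I * (lam : ℂ) * u) := by
  rw [tfT, integral_Icc_eq_integral_Ioc, ← intervalIntegral.integral_of_le (by norm_num)]

/-- `norm_cexp_I_mul` — helper of the x-wuc GEN-11 chain «K1′(ℝ) at the stake» (verbatim from the referee-passed extract `SplitXWucK1R.lean` 70c8eb2af2868881; role: see the module docstring). -/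
theorem norm_cexp_I_mul (a u : ℝ) : ‖cexp (I * (a : ℂ) * u)‖ = 1 := by
  rw [show I * (a : ℂ) * u = ((a * u : ℝ) : ℂ) * I by push_cast; ring]
  exact Complex.norm_exp_ofReal_mul_I _

end dent
end Summit.RiemannHypothesis.RiemannHypothesis.Theorems.Splittings.XWucG8.CoshKernel
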